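import Summits.BirchSwinnertonDyer.Rank1Residual.GaloisImage.KolyvaginDerivativeLocalImageRat
import HarnessLib

/-!
# THEOREM B of row T-DER at the bad places over `ℚ` through a cyclotomic layer: the local degree at
# layer `i` and the assembled END — file 4b of row T-DER-BN
# (cell `b2b-bsdres`, team n1011, seat p15 GEN 6; skeleton `cells/n1011/skel/T-DER-BN.md` STATUS v5)

HONEST FRAMING (cell `b2b-bsdres`, run/shared/lean/b2b/bsd-rank1-residual/, verbatim in every
file): the goal of the cell is to DELETE the COMBINATION-SHAPED residual classes of the
Birch–Swinnerton-Dyer formula for ALL analytic-rank `≤ 1` elliptic curves over `ℚ` — "full BSD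
formula for every rank `≤ 1` curve in class `C`" assembled STRICTLY from published theorems — so
that the rank-`≤ 1` remainder becomes exactly the CONSTRUCTION-SHAPED classes, which are TYPED
(missing-input `Prop`s), NOT attempted. This is not "finishing BSD". Team n1011 (N10 / N11, the
additive block X4 ∧ `p = 3`): research route on the CONSTRUCTION-SHAPED class X4; no claim beyond the
stated classes; nothing is booked. TOOL theorems (no definition, no named fact, no `sorry`).

## What

§1 **The index at layer `i`** (`index_range_inf_rootsOfUnityFixer_layer`): for a finite place `w`
of `ℚ` with `w ∤ n q`, the decomposition group `D_w = res(Γ_{ℚ_w})` satisfies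
`[D_w ∩ Gal(ℚ̄/ℚ(μ_q)) : D_w ∩ Gal(ℚ̄/ℚ(μ_q)) ∩ Gal(ℚ̄/ℚ(μ_n))] = ord((w mod n)^{ord(w mod q)})`:
`(χ_n × χ_q)(D_w)` is the cyclic group generated by `(w, w)` (file 4's mechanism), and its
intersection with the kernel of the second projection is generated by `(w, w)^{ord(w mod q)}`
(`zpowers_inf_ker_snd`).  With `q = p^i`, `n = ∏_{ℓ ∈ r} ℓ` this is the residue degree of `w` in
`ℚ(μ_{p^i r}) / ℚ(μ_{p^i})`; it is prime to `p` iff `v_p(ord(w mod ∏ℓ)) ≤ v_p(ord(w mod p^i))` —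
the `p`-part of the degree of `w` in `ℚ(μ_r)` is ABSORBED by the layer `ℚ(μ_{p^i})`.
§2 **THEOREM B at the bad places through the layer `i`, over `ℚ`**
(`Rat.exists_map_red_eq_localization_of_layer`): for `cyclotomicLevelsRat p S`, an Euler system
`hc`, `red : T ⟶ T′` with `p^k T′ = 0`, a level `r` of Kolyvagin primes `ℓ` with moreover
`ℓ ≡ 1 (mod p^i)` (`hri` — the primes split in `ℚ(μ_{p^i})`, Rubin's admissibility at base
`F = ℚ(μ_{p^i})`), `(T′)^{Gal(ℚ̄/ℚ(μ_{p^i r}))} = 0` (`h0i`), and the bottom derivative class `κ`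
(F5's shape): at every finite `w ∉ r`, `w ≠ p` with
`¬ p ∣ ord((w mod ∏ℓ)^{ord(w mod p^i)})`, `res_w^* κ` is `red_*` of a class of `H¹(ℚ_w, T)`.
Assembly: file 2 (`existsUnique_resLe_eq_deriv` at layer `i` with F3b's binders discharged over `ℚ`
as in F5, `cores_eq_of_resLe_eq_deriv` with file 4's `hdisj`), file 3
(`exists_map_red_eq_resSubgroup_cores`), §1, file 4 §0.

References: K. Rubin, *Euler Systems* (2000), §4.4–4.6, Thm. 4.5.1; B. Mazur, K. Rubin, Mem. AMS
799 (2004), Thm. 3.2.4, Def. 3.1.8; J. Neukirch, *ANT*, Ch. I (10.3), Ch. II (9.6).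
-/

noncomputable section

open CategoryTheory Function Finset Polynomial Field IsDedekindDomain
open scoped NumberField Classical
open Literature.NumberTheory.GaloisRepresentations
open Literature.NumberTheory.GaloisRepresentations.IsNonarchimedeanLocalField

universe u v

namespace Summit.BirchSwinnertonDyer.Rank1Residual.GaloisImage

namespace Derivative

/-! ### §1 The index at layer `i` -/

section Layer

open Rat.HeightOneSpectrum

/-- In a product of groups, the powers of `x` with trivial second component are the powers of
`x ^ ord(x.2)`. [folklore] -/
theorem zpowers_inf_ker_snd {P Q : Type*} [Group P] [Group Q] (x : P × Q) :
    Subgroup.zpowers x ⊓ (MonoidHom.snd P Q).ker = Subgroup.zpowers (x ^ orderOf x.2) := by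
  ext h
  simp only [Subgroup.mem_inf, Subgroup.mem_zpowers_iff, MonoidHom.mem_ker, MonoidHom.coe_snd]
  have hsnd : ∀ k : ℤ, (x ^ k).2 = x.2 ^ k := fun k => (MonoidHom.snd P Q).map_zpow x k
  constructor
  · rintro ⟨⟨k, rfl⟩, hk⟩
    rw [hsnd] at hk
    obtain ⟨j, rfl⟩ := orderOf_dvd_iff_zpow_eq_one.mpr hk
    exact ⟨j, by rw [← zpow_natCast, ← zpow_mul]⟩
  · rintro ⟨j, rfl⟩
    refine ⟨⟨(orderOf x.2 : ℤ) * j, by rw [zpow_mul, zpow_natCast]⟩, ?_⟩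
    rw [← zpow_natCast, ← zpow_mul, hsnd, zpow_mul, zpow_natCast, pow_orderOf_eq_one, one_zpow]

/-- **`[D_w ∩ Gal(ℚ̄/ℚ(μ_q)) : D_w ∩ Gal(ℚ̄/ℚ(μ_q)) ∩ Gal(ℚ̄/ℚ(μ_n))] = ord((w mod n)^{ord(w mod q)})`**
for `w ∤ n`, `w ∤ q`, `D_w = res(Γ_{ℚ_w})`: the image of `Γ_{ℚ_w}` under `χ_n × χ_q` is the cyclic
group generated by `(w, w)` (inertia acts trivially, `Γ_{ℚ_w}` is generated by inertia and a
Frobenius), and the elements with trivial `χ_q`-component are the powers of `(w, w)^{ord(w mod q)}`.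
For `q = p^i`, `n = ∏ℓ`: the residue degree of `w` in `ℚ(μ_{p^i n}) / ℚ(μ_{p^i})`.  Neukirch,
*ANT* II (9.6), I (10.3). [folklore] -/
theorem index_range_inf_rootsOfUnityFixer_layer {n q : ℕ} [NeZero n] [NeZero q]
    (w : HeightOneSpectrum (𝓞 ℚ)) (hn : ¬ ((primesEquiv w : Nat.Primes) : ℕ) ∣ n)
    (hq : ¬ ((primesEquiv w : Nat.Primes) : ℕ) ∣ q) :
    ((((absGaloisRestrict ℚ (w.adicCompletion ℚ)).toMonoidHom.range ⊓ rootsOfUnityFixer ℚ q) ⊓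
        rootsOfUnityFixer ℚ n).subgroupOf
        ((absGaloisRestrict ℚ (w.adicCompletion ℚ)).toMonoidHom.range ⊓ rootsOfUnityFixer ℚ q)).index =
      orderOf (((((primesEquiv w : Nat.Primes) : ℕ) : ZMod n)) ^
        orderOf ((((primesEquiv w : Nat.Primes) : ℕ) : ZMod q))) := by
  set L := w.adicCompletion ℚ with hL
  set res := (absGaloisRestrict ℚ L).toMonoidHom with hres
  set χn := modNCyclotomicCharacter ℚ n with hχn
  set χq := modNCyclotomicCharacter ℚ q with hχq
  set h := (χn.comp res).prod (χq.comp res) with hh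
  -- the subgroup is the kernel of `χ_n` on `A = res(ker (χ_q ∘ res))`
  rw [Subgroup.inf_subgroupOf_left, rootsOfUnityFixer_eq_ker ℚ n, ← MonoidHom.ker_restrict,
    Subgroup.index_ker, MonoidHom.restrict_range]
  have hA : res.range ⊓ rootsOfUnityFixer ℚ q = (((MonoidHom.snd _ _).ker).comap h).map res := by
    rw [rootsOfUnityFixer_eq_ker ℚ q, ← Subgroup.map_comap_eq, MonoidHom.comap_ker, MonoidHom.comap_ker,
      MonoidHom.snd_comp_prod]
  rw [hA, Subgroup.map_map, show χn.comp res = (MonoidHom.fst _ _).comp h by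
    rw [hh, MonoidHom.fst_comp_prod], ← Subgroup.map_map, Subgroup.map_comap_eq]
  -- the image of `Γ_{ℚ_w}` under `h = (χ_n × χ_q) ∘ res` is generated by `h(Frob)`
  have h𝔓₀ := adicCompletionPrime_mem_primesAbove ℚ w
  haveI := h𝔓₀.1
  obtain ⟨φ, hφ⟩ := exists_isAbsArithFrob_holds L
  have hIres : ∀ t ∈ absInertia L, res t ∈ (adicCompletionPrime ℚ w).inertia (absoluteGaloisGroup ℚ) :=
    fun t ht => by
      rw [inertia_adicCompletionPrime_eq_map_absInertia]
      exact Subgroup.mem_map_of_mem _ ht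
  have hI : absInertia L ≤ h.ker := fun t ht => by
    rw [MonoidHom.mem_ker, hh, MonoidHom.prod_apply, Prod.mk_eq_one, MonoidHom.comp_apply,
      MonoidHom.comp_apply]
    exact ⟨modNCyclotomicCharacter_eq_one_of_mem_inertia
        (Rat.natCast_not_mem_of_mem_primesAbove_of_not_dvd h𝔓₀ hn) (hIres t ht),
      modNCyclotomicCharacter_eq_one_of_mem_inertia
        (Rat.natCast_not_mem_of_mem_primesAbove_of_not_dvd h𝔓₀ hq) (hIres t ht)⟩
  have hopen : IsOpen ((h.ker : Subgroup (absoluteGaloisGroup L)) : Set (absoluteGaloisGroup L)) := by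
    have e : ((h.ker : Subgroup (absoluteGaloisGroup L)) : Set (absoluteGaloisGroup L)) =
        res ⁻¹' (rootsOfUnityFixer ℚ n : Set (absoluteGaloisGroup ℚ)) ∩
          res ⁻¹' (rootsOfUnityFixer ℚ q : Set (absoluteGaloisGroup ℚ)) := by
      ext t
      rw [rootsOfUnityFixer_eq_ker ℚ n, rootsOfUnityFixer_eq_ker ℚ q, SetLike.mem_coe, MonoidHom.mem_ker, hh,
        MonoidHom.prod_apply, Prod.mk_eq_one, Set.mem_inter_iff, Set.mem_preimage, Set.mem_preimage,
        SetLike.mem_coe, SetLike.mem_coe, MonoidHom.mem_ker, MonoidHom.mem_ker, MonoidHom.comp_apply,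
        MonoidHom.comp_apply]
    rw [e]
    exact ((isOpen_rootsOfUnityFixer ℚ n).preimage (absGaloisRestrict ℚ L).continuous_toFun).inter
      ((isOpen_rootsOfUnityFixer ℚ q).preimage (absGaloisRestrict ℚ L).continuous_toFun)
  rw [range_eq_zpowers_of_absInertia_le_ker h hopen hI hφ, zpowers_inf_ker_snd,
    MonoidHom.map_zpowers, Nat.card_zpowers]
  -- `h φ = (w, w)`
  have hFr : IsArithFrobAtPlace ℚ w (res φ) :=
    ⟨_, h𝔓₀, (isArithFrobAt_absGaloisRestrict_adicCompletionPrime_iff ℚ w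
      (by rw [Literature.NumberTheory.Automorphic.residueFieldCard_adicCompletion_eq ℚ w,
        HeightOneSpectrum.residueCard_eq_card_quotient]) φ).2 hφ⟩
  have hvn := CyclotomicLevel.Rat.modNCyclotomicCharacter_of_isArithFrobAtPlace hn hFr
  have hvq := CyclotomicLevel.Rat.modNCyclotomicCharacter_of_isArithFrobAtPlace hq hFr
  have h1 : (h φ).1 = χn (res φ) := rfl
  have h2 : (h φ).2 = χq (res φ) := rfl
  rw [map_pow, MonoidHom.coe_fst, h1, h2, ← orderOf_units, Units.val_pow_eq_pow_val, hvn,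
    ← orderOf_units, hvq]

end Layer

/-! ### §2 THEOREM B at the bad places through a cyclotomic layer, over `ℚ` -/

section RatLayer

open Rat.HeightOneSpectrum

variable {p : ℕ} [Fact p.Prime] {S : Set (HeightOneSpectrum (𝓞 ℚ))}
variable {M : Type} [AddCommGroup M] [Module ℤ_[p] M] [TopologicalSpace M] [IsTopologicalAddGroup M]
  [ContinuousSMul ℤ_[p] M] [Module.Free ℤ_[p] M] [Module.Finite ℤ_[p] M] {T : GaloisRep ℚ ℤ_[p] M}
variable {c : ∀ (i : ℕ) (r : (cyclotomicLevelsRat p S).Ideals), H1 T ((cyclotomicLevelsRat p S).level i r.1)}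
variable {M' : Type} [AddCommGroup M'] [Module ℤ_[p] M'] [TopologicalSpace M']
  [IsTopologicalAddGroup M'] [ContinuousSMul ℤ_[p] M'] {T' : GaloisRep ℚ ℤ_[p] M'}

/-- **THEOREM B of row T-DER at a place `w ∉ r`, `w ≠ p`, through the layer `ℚ(μ_{p^i})`.**
For the cyclotomic levels `cyclotomicLevelsRat p S`, an Euler system `c` (`hc`), a coefficient map
`red : T ⟶ T′`, a level `r` of usable primes `ℓ ≠ 2` with the chosen generators `σ_ℓ` and Frobenii
`Fr_ℓ` of F4/F5 (`hσ hcov hinj hcop hFr`), `T′` killed by `ℓ − 1` and `P_ℓ(1)` (`hM₁ hM₂`), the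
bottom derivative class `κ` (`hκ`, F4/F5's shape; `h0`), and a layer `i` with **`ℓ ≡ 1 (mod p^i)` for
all `ℓ ∈ r`** (`hri` — the primes split in `ℚ(μ_{p^i})`) and `(T′)^{Gal(ℚ̄/ℚ(μ_{p^i r}))} = 0`
(`h0i`): at every finite place `w ∉ r`, `w ≠ p` with
**`¬ p ∣ ord((w mod ∏ℓ)^{ord(w mod p^i)})`** (`hord` — the `p`-part of the degree of `w` in `ℚ(μ_r)`
is absorbed by `ℚ(μ_{p^i})`), `res_w^* κ` is `red_*` of a class of `H¹(ℚ_w, T)` — the local condition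
`𝓕_can,w = 𝓛_w`, with no hypothesis on `T` at `w`.  Assembly: file 2's layer-`i` class `κ_i` and
`Cor_{ℚ(μ_{p^i})/ℚ} κ_i = κ` (`IsEulerSystem.cores_p`, `hdisj` = file 4's
`Rat.exists_mem_level_bot_inv_mul_mem_pLevel`), file 3's `exists_map_red_eq_resSubgroup_cores` with
`a = [·]⁻¹ ∈ ℤ_pˣ` (index = §1), file 4 §0.
[cite: Rubin2000, Thm. 4.5.1 and §4.4] [cite: MazurRubin2004, Thm. 3.2.4 and App. A Prop. A.2] -/
theorem Rat.exists_map_red_eq_localization_of_layer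
    (hc : IsEulerSystem (cyclotomicLevelsRat p S) T p c) (red : T.toTopRep ⟶ T'.toTopRep)
    (r : (cyclotomicLevelsRat p S).Ideals) (σ Fr : HeightOneSpectrum (𝓞 ℚ) → absoluteGaloisGroup ℚ)
    (hσ : ∀ ℓ ∈ r.1, ∀ q ∈ r.1, q ≠ ℓ → σ ℓ ∈ (cyclotomicLevelsRat p S).tameLevel q)
    (hcov : ∀ ℓ ∈ r.1, ∀ g : absoluteGaloisGroup ℚ,
      ∃ j < ((primesEquiv ℓ : Nat.Primes) : ℕ) - 1, (σ ℓ ^ j)⁻¹ * g ∈ (cyclotomicLevelsRat p S).tameLevel ℓ)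
    (hinj : ∀ ℓ ∈ r.1, ∀ j₁ < ((primesEquiv ℓ : Nat.Primes) : ℕ) - 1,
      ∀ j₂ < ((primesEquiv ℓ : Nat.Primes) : ℕ) - 1,
        (σ ℓ ^ j₁)⁻¹ * σ ℓ ^ j₂ ∈ (cyclotomicLevelsRat p S).tameLevel ℓ → j₁ = j₂)
    (hcop : ∀ ℓ ∈ r.1, ∀ m : ℕ, (((primesEquiv ℓ : Nat.Primes) : ℕ)).Coprime m →
      σ ℓ ∈ rootsOfUnityFixer ℚ m)
    (hFr : ∀ ℓ ∈ r.1, IsArithFrobAtPlace ℚ ℓ (Fr ℓ))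
    (h2 : ∀ ℓ ∈ r.1, ((primesEquiv ℓ : Nat.Primes) : ℕ) ≠ 2)
    (hM₁ : ∀ ℓ ∈ r.1, ∀ v : M', ((((primesEquiv ℓ : Nat.Primes) : ℕ) - 1 : ℕ) : ℤ_[p]) • v = 0)
    (hM₂ : ∀ ℓ ∈ r.1, ∀ v : M',
      (rubinEulerFactor T.toRepresentation (cyclotomicCharacterToUnits ℚ p ℤ_[p]) (Fr ℓ)).eval 1 • v = 0)
    (comm)
    (h0 : ∀ v : T'.toTopRep, (∀ u : (cyclotomicLevelsRat p S).level ⊥ r.1,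
      T'.toTopRep.ρ (u : absoluteGaloisGroup ℚ) v = v) → v = 0)
    (i : ℕ) (hri : ∀ ℓ ∈ r.1, ((primesEquiv ℓ : Nat.Primes) : ℕ) ≡ 1 [MOD p ^ i])
    (h0i : ∀ v : T'.toTopRep, (∀ u : (cyclotomicLevelsRat p S).level i r.1,
      T'.toTopRep.ρ (u : absoluteGaloisGroup ℚ) v = v) → v = 0)
    (κ : continuousCohomology 1 T'.toTopRep)
    (hκ : resSubgroup T'.toTopRep ((cyclotomicLevelsRat p S).level ⊥ r.1) 1 κ =
        (r.1.noncommProd (fun ℓ => ∑ j ∈ range (((primesEquiv ℓ : Nat.Primes) : ℕ) - 1),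
          (j : Module.End ℤ_[p] (continuousCohomology 1
            (subgroupRep T'.toTopRep ((cyclotomicLevelsRat p S).level ⊥ r.1)))) *
          (conjMap T'.toTopRep ((cyclotomicLevelsRat p S).level ⊥ r.1) (σ ℓ) 1).hom.toLinearMap ^ j) comm)
        (ContinuousCohomology.map (ContinuousMonoidHom.id _)
          (X := subgroupRep T.toTopRep ((cyclotomicLevelsRat p S).level ⊥ r.1))
          (Y := subgroupRep T'.toTopRep ((cyclotomicLevelsRat p S).level ⊥ r.1))
          ((TopRep.resFunctor ((cyclotomicLevelsRat p S).level ⊥ r.1).subtype).map red) 1 (c ⊥ r)))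
    (w : HeightOneSpectrum (𝓞 ℚ)) (hw : ∀ q ∈ r.1, q ≠ w)
    (hwp : ((primesEquiv w : Nat.Primes) : ℕ) ≠ p)
    (hord : ¬ p ∣ orderOf (((((primesEquiv w : Nat.Primes) : ℕ) :
        ZMod (∏ q ∈ r.1, ((primesEquiv q : Nat.Primes) : ℕ)))) ^
      orderOf ((((primesEquiv w : Nat.Primes) : ℕ) : ZMod (p ^ i))))) :
    ∃ z' : continuousCohomology 1
        (TopRep.res (absGaloisRestrict ℚ (w.adicCompletion ℚ)).toMonoidHom T.toTopRep),
      ContinuousCohomology.map (ContinuousMonoidHom.id (absoluteGaloisGroup (w.adicCompletion ℚ)))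
        (X := TopRep.res (absGaloisRestrict ℚ (w.adicCompletion ℚ)).toMonoidHom T.toTopRep)
        (Y := TopRep.res (absGaloisRestrict ℚ (w.adicCompletion ℚ)).toMonoidHom T'.toTopRep)
        ((TopRep.resFunctor (absGaloisRestrict ℚ (w.adicCompletion ℚ)).toMonoidHom).map red) 1 z' =
      ContinuousCohomology.map (absGaloisRestrict ℚ (w.adicCompletion ℚ))
        (𝟙 (TopRep.res (absGaloisRestrict ℚ (w.adicCompletion ℚ)).toMonoidHom T'.toTopRep)) 1 κ := by
  classical
  set m : ℕ := ∏ q ∈ r.1, ((primesEquiv q : Nat.Primes) : ℕ) with hm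
  haveI : NeZero m := ⟨Finset.prod_ne_zero_iff.mpr fun q _ => (primesEquiv q).2.ne_zero⟩
  haveI : NeZero (p ^ i) := ⟨pow_ne_zero i (Fact.out : p.Prime).ne_zero⟩
  -- finiteness of the quotients involved
  haveI : CompactSpace (absoluteGaloisGroup ℚ) := absoluteGaloisGroup_compactSpace ℚ
  haveI hΓfi : ((cyclotomicLevelsRat p S).pLevel i).FiniteIndex := finiteIndex_of_isOpen_of_compactSpace _ ((cyclotomicLevelsRat p S).isOpen_pLevel i)
  haveI : Fintype (absoluteGaloisGroup ℚ ⧸ (cyclotomicLevelsRat p S).pLevel i) := Fintype.ofFinite _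
  -- layer-`i` binders over `ℚ`
  have hprimes : ∀ ℓ ∈ r.1, ℓ ∈ (cyclotomicLevelsRat p S).primes := fun ℓ hℓ => r.2 ℓ hℓ
  have hσp : ∀ ℓ ∈ r.1, σ ℓ ∈ (cyclotomicLevelsRat p S).pLevel i := fun ℓ hℓ =>
    CyclotomicLevel.Rat.sigma_mem_pLevel_cyclotomicLevelsRat p S i (hprimes ℓ hℓ) (hcop ℓ hℓ)
  have hFrp : ∀ ℓ ∈ r.1, Fr ℓ ∈ (cyclotomicLevelsRat p S).pLevel i := fun ℓ hℓ =>
    CyclotomicLevel.Rat.frobenius_mem_pLevel_cyclotomicLevelsRat p S i (hprimes ℓ hℓ) (hri ℓ hℓ) (hFr ℓ hℓ)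
  have hram : ∀ (k : ℕ), ∀ ℓ ∈ r.1, ∀ s ⊆ r.1, ℓ ∉ s →
      ¬ SubgroupIsUnramifiedAt ℚ ((cyclotomicLevelsRat p S).level k (insert ℓ s)) ℓ := fun k ℓ hℓ s _ _ =>
    CyclotomicLevel.Rat.not_subgroupIsUnramifiedAt_cyclotomicLevelsRat_level_insert p S k (h2 ℓ hℓ) s
  -- the layer-`i` derivative class and its norm
  obtain ⟨κi, hκi, -⟩ := existsUnique_resLe_eq_deriv hc red i r σ _ Fr hσp hσ hcov hinj hFrp hFr (hram i)
    hM₁ hM₂ (pairwise_commute_deriv i r.1 σ _) h0i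
  have hcores : cores T'.toTopRep ((cyclotomicLevelsRat p S).pLevel i) ((cyclotomicLevelsRat p S).isOpen_pLevel i) κi = κ :=
    cores_eq_of_resLe_eq_deriv hc red i r σ _ Fr hσ hcov hinj hFr (hram ⊥) hM₁ hM₂ comm h0
      (Rat.exists_mem_level_bot_inv_mul_mem_pLevel p S r i) _ κi hκi κ hκ
  -- the decomposition group `D_w` and its index data
  set D : Subgroup (absoluteGaloisGroup ℚ) :=
    (absGaloisRestrict ℚ (w.adicCompletion ℚ)).toMonoidHom.range with hD
  haveI : (D ⊔ (cyclotomicLevelsRat p S).pLevel i).FiniteIndex := Subgroup.finiteIndex_of_le le_sup_right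
  haveI : Fintype (absoluteGaloisGroup ℚ ⧸ (D ⊔ (cyclotomicLevelsRat p S).pLevel i)) := Fintype.ofFinite _
  haveI : ((D ⊓ (cyclotomicLevelsRat p S).pLevel i).subgroupOf D).FiniteIndex := by
    rw [Subgroup.inf_subgroupOf_left]; infer_instance
  haveI : Fintype (D ⧸ (D ⊓ (cyclotomicLevelsRat p S).pLevel i).subgroupOf D) := Fintype.ofFinite _
  haveI : ((D ⊓ (cyclotomicLevelsRat p S).pLevel i ⊓ (cyclotomicLevelsRat p S).level ⊥ r.1).subgroupOf (D ⊓ (cyclotomicLevelsRat p S).pLevel i)).FiniteIndex := by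
    rw [Subgroup.inf_subgroupOf_left]; infer_instance
  haveI : Fintype ((D ⊓ (cyclotomicLevelsRat p S).pLevel i : Subgroup (absoluteGaloisGroup ℚ)) ⧸
      (D ⊓ (cyclotomicLevelsRat p S).pLevel i ⊓ (cyclotomicLevelsRat p S).level ⊥ r.1).subgroupOf (D ⊓ (cyclotomicLevelsRat p S).pLevel i)) := Fintype.ofFinite _
  -- the index is `ord((w mod m)^{ord(w mod p^i)})`, prime to `p`
  have hwm : ¬ ((primesEquiv w : Nat.Primes) : ℕ) ∣ m := by
    intro h
    obtain ⟨q, hq, hdvd⟩ := ((primesEquiv w).2.prime.dvd_finsetProd_iff _).mp h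
    have heq : ((primesEquiv w : Nat.Primes) : ℕ) = primesEquiv q :=
      (Nat.prime_dvd_prime_iff_eq (primesEquiv w).2 (primesEquiv q).2).mp hdvd
    exact hw q hq (primesEquiv.injective (Subtype.ext heq.symm))
  have hwq : ¬ ((primesEquiv w : Nat.Primes) : ℕ) ∣ p ^ i := fun h =>
    hwp ((Nat.prime_dvd_prime_iff_eq (primesEquiv w).2 Fact.out).mp ((primesEquiv w).2.dvd_of_dvd_pow h))
  have hidx : ((D ⊓ (cyclotomicLevelsRat p S).pLevel i ⊓ (cyclotomicLevelsRat p S).level ⊥ r.1).subgroupOf (D ⊓ (cyclotomicLevelsRat p S).pLevel i)).index =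
      orderOf (((((primesEquiv w : Nat.Primes) : ℕ) : ZMod m)) ^
        orderOf ((((primesEquiv w : Nat.Primes) : ℕ) : ZMod (p ^ i)))) := by
    rw [cyclotomicLevelsRat_level_bot_eq_rootsOfUnityFixer_prod]
    exact index_range_inf_rootsOfUnityFixer_layer w hwm hwq
  have hord' : ¬ p ∣ ((D ⊓ (cyclotomicLevelsRat p S).pLevel i ⊓ (cyclotomicLevelsRat p S).level ⊥ r.1).subgroupOf
      (D ⊓ (cyclotomicLevelsRat p S).pLevel i)).index := by
    rw [hidx]; exact hord
  have hu := isUnit_natCast_padicInt_of_not_dvd hord'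
  -- file 3 at layer `i`, then file 4 §0
  obtain ⟨z, hz⟩ := exists_map_red_eq_resSubgroup_cores red i r σ _ (pairwise_commute_deriv i r.1 σ _)
    κi hκi D (↑hu.unit⁻¹ : ℤ_[p]) (fun v => by rw [IsUnit.val_inv_mul, one_smul])
  rw [hcores] at hz
  exact exists_map_red_eq_map_of_forall_mem red (absGaloisRestrict ℚ (w.adicCompletion ℚ)) D
    (fun h => ⟨h, rfl⟩) κ z hz

end RatLayer

end Derivative

end Summit.BirchSwinnertonDyer.Rank1Residual.GaloisImage

end
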